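import Mathlib.RingTheory.Ideal.KrullsHeightTheorem
import Mathlib.RingTheory.Ideal.MinimalPrime.Noetherian
import Mathlib.RingTheory.Polynomial.ScaleRoots
import Mathlib.RingTheory.Polynomial.Basic
import Mathlib.RingTheory.Localization.FractionRing
import Mathlib.Algebra.Polynomial.Div
import HarnessLib

/-!
# The pencil `A[g/h]` through two points: kernel, primality and sections

Topic `Literature/AlgebraicGeometry/Motives`; commutative algebra for the two-point curve lemma
(`Motives/CurveThroughTwoPoints`, fact `mumford_smoothCurve_through_two_points`: "any two points
of an irreducible variety lie on an irreducible curve", Mumford, *Abelian Varieties*, §6). For a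
noetherian domain `A` and elements `g, h` consider the `A`-algebra map
`φ : A[X] → Frac A`, `X ↦ g/h` (`pencilHom g h`), whose image is the ring `A[g/h]` of the affine
chart `h ≠ 0` of the blow-up of the ideal `(g, h)` — geometrically the closure `T ⊆ Spec A × 𝔸¹` of
the graph of the pencil `g/h : Spec A ⇢ 𝔸¹`.

* `pow_natDegree_mul_mem_span_of_aeval_div_eq_zero` — if `p(g/h) = 0` then
  `h^{deg p} · p ∈ (g − X h)` (the scaled polynomial `scaleRoots p h` has the root `g`);
* `C_notMem_of_mem_minimalPrimes_pencil` — if every minimal prime of `(g, h)` has height `≥ 2`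
  (`two_le_height_of_mem_minimalPrimes_span_pair`: e.g. `g ≠ 0` and `h` outside the minimal
  primes of `(g)`), then no minimal prime of the principal ideal `(g − X h) ⊆ A[X]` contains `h`
  (such a prime would contain `(g, h)A[X]`, of height `≥ 2`, against Krull's principal ideal
  theorem);
* `ker_pencilHom_eq_radical` — hence **`ker φ = √(g − X h)`**: every minimal prime of `(g − X h)`
  contains `ker φ`, so `√(g − X h) = ⋂ (minimal primes) ⊇ ker φ ⊇ √(g − X h)`;
* `map_eq_zero_of_mem_ker_pencilHom` — consequently **the two points give sections**: for a ring
  map `ev : A → R` to a reduced ring killing `g` and `h` (e.g. `A → A/𝔪ᵢ` for maximal ideals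
  `𝔪₁, 𝔪₂ ∋ g, h`), `p ↦ p^{ev} : A[X] → R[X]` vanishes on `ker φ`, i.e. factors through
  `A[g/h] ≅ A[X]/ker φ`: the lines `{𝔪ᵢ} × 𝔸¹` lie on `T`;
* `exists_mem_inf_notMem_minimalPrimes` — for distinct maximal ideals `𝔪₁, 𝔪₂` of height `≥ 2`
  there are `g ≠ 0` and `h` in `𝔪₁ ∩ 𝔪₂` with `h` outside the minimal primes of `(g)` (prime
  avoidance).

Everything here is proved; no named facts. These are steps of an elementary proof of Mumford's
lemma recorded in the notes of the fact's literature unit (pencil through the two points, relative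
algebraic closure, Noether irreducibility forms); the printed proof (blow up the two points and
apply Bertini's theorem) is not formalisable with the present library.

## References

* D. Mumford, *Abelian Varieties* (1970), §6, Lemma. [MumfordAV1970]
* H. Matsumura, *Commutative Ring Theory* (1986), Thm. 13.5 (Krull's principal ideal theorem),
  used through Mathlib. [Matsumura1987]
-/

noncomputable section

open Polynomial

namespace Literature.AlgebraicGeometry.Motives

namespace TwoPointPencil

universe u

variable {A : Type u} [CommRing A] [IsDomain A]

/-- The pencil map `φ : A[X] → Frac A`, `X ↦ g/h`, whose image is `A[g/h]`. [folklore] -/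
def pencilHom (g h : A) : A[X] →ₐ[A] FractionRing A :=
  Polynomial.aeval (algebraMap A (FractionRing A) g / algebraMap A (FractionRing A) h)

/-- `φ(X) = g/h`. [folklore] -/
@[simp] theorem pencilHom_X (g h : A) :
    pencilHom g h X = algebraMap A (FractionRing A) g / algebraMap A (FractionRing A) h := by
  simp [pencilHom]

/-- `φ` restricted to `A` is the inclusion `A ⊆ Frac A`. [folklore] -/
@[simp] theorem pencilHom_C (g h a : A) : pencilHom g h (C a) = algebraMap A (FractionRing A) a := by
  simp [pencilHom]

/-- `φ(g − X h) = 0` (for `h ≠ 0`). [folklore] -/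
theorem pencilHom_C_sub_X_mul_C {g h : A} (hh : h ≠ 0) : pencilHom g h (C g - X * C h) = 0 := by
  have hh' : algebraMap A (FractionRing A) h ≠ 0 :=
    fun e => hh ((IsFractionRing.injective A (FractionRing A)) (by rw [e, map_zero]))
  simp only [pencilHom, map_sub, map_mul, aeval_C, aeval_X]
  rw [div_mul_cancel₀ _ hh', sub_self]

/-- The principal ideal `(g − X h) ⊆ A[X]` lies in `ker φ`. [folklore] -/
theorem span_le_ker_pencilHom {g h : A} (hh : h ≠ 0) :
    Ideal.span {C g - X * C h} ≤ RingHom.ker (pencilHom g h) := by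
  rw [Ideal.span_le, Set.singleton_subset_iff]
  exact pencilHom_C_sub_X_mul_C hh

/-- **If `p(g/h) = 0` then `h^{deg p} p ∈ (g − X h)`.** The scaled polynomial
`P = scaleRoots p h` satisfies `P(hX) = h^{deg p} p(X)` and `P(g) = h^{deg p} p(g/h) = 0`, so
`P = (X − g) Q` and `h^{deg p} p = P(hX) = (hX − g) Q(hX)`. [folklore] -/
theorem pow_natDegree_mul_mem_span_of_aeval_div_eq_zero {g h : A} (hh : h ≠ 0) {p : A[X]}
    (hp : pencilHom g h p = 0) : C h ^ p.natDegree * p ∈ Ideal.span {C g - X * C h} := by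
  set F := FractionRing A
  have hinj : Function.Injective (algebraMap A F) := IsFractionRing.injective A F
  have hhF : algebraMap A F h ≠ 0 := fun e => hh (hinj (by rw [e, map_zero]))
  set P : A[X] := scaleRoots p h with hP
  -- `P(g) = 0` in `A`
  have hPg : P.IsRoot g := by
    have h1 := scaleRoots_eval₂_mul (p := p) (algebraMap A F)
      (algebraMap A F g / algebraMap A F h) h
    rw [mul_div_cancel₀ _ hhF] at h1
    have h2 : eval₂ (algebraMap A F) (algebraMap A F g / algebraMap A F h) p = 0 := hp
    rw [h2, mul_zero, eval₂_at_apply] at h1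
    exact hinj (by rw [map_zero]; exact h1)
  -- `P = (X - C g) * Q`
  have hPQ : (X - C g) * (P /ₘ (X - C g)) = P := mul_divByMonic_eq_iff_isRoot.mpr hPg
  set Q := P /ₘ (X - C g) with hQ
  -- substitute `X ↦ h X`
  have hcomp : P.comp (C h * X) = C h ^ p.natDegree * p := by
    have h1 := scaleRoots_eval₂_mul (p := p) (C : A →+* A[X]) X h
    rw [eval₂_C_X] at h1
    exact h1
  have hcomp' : P.comp (C h * X) = (C h * X - C g) * Q.comp (C h * X) := by
    rw [← hPQ, mul_comp, sub_comp, X_comp, C_comp]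
  rw [← hcomp, hcomp', show C h * X - C g = -(C g - X * C h) by ring, neg_mul]
  exact (Submodule.neg_mem_iff _).mpr (Ideal.mul_mem_right _ _ (Ideal.subset_span (Set.mem_singleton _)))

/-! ### Heights: no minimal prime of `(g − X h)` contains `h` -/

variable [IsNoetherianRing A]

/-- If `g ≠ 0` and `h` lies in no minimal prime of `(g)`, every minimal prime of `(g, h)` has
height `≥ 2`: a minimal prime `𝔭 ∋ g, h` contains a minimal prime `𝔭'` of `(g)`, of height `1`
(Krull), and `𝔭' ≠ 𝔭` since `h ∉ 𝔭'`. [folklore] -/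
theorem two_le_height_of_mem_minimalPrimes_span_pair {g h : A} (hg : g ≠ 0)
    (hgh : ∀ 𝔭 ∈ (Ideal.span {g}).minimalPrimes, h ∉ 𝔭) {𝔭 : Ideal A}
    (h𝔭 : 𝔭 ∈ (Ideal.span {g, h}).minimalPrimes) : 2 ≤ 𝔭.height := by
  haveI := h𝔭.1.1
  have hg𝔭 : g ∈ 𝔭 := h𝔭.1.2 (Ideal.subset_span (by simp))
  have hh𝔭 : h ∈ 𝔭 := h𝔭.1.2 (Ideal.subset_span (by simp))
  obtain ⟨𝔭', h𝔭'min, h𝔭'le⟩ :=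
    Ideal.exists_minimalPrimes_le (I := Ideal.span {g}) ((Ideal.span_singleton_le_iff_mem _).mpr hg𝔭)
  haveI := h𝔭'min.1.1
  have h1 : 𝔭'.height = 1 := by
    apply le_antisymm (Ideal.height_le_one_of_isPrincipal_of_mem_minimalPrimes _ 𝔭' h𝔭'min)
    rw [Order.one_le_iff_ne_zero, Ne, Ideal.height_eq_zero_iff_eq_bot]
    rintro rfl
    exact hg ((Submodule.mem_bot A).mp (h𝔭'min.1.2 (Ideal.subset_span (Set.mem_singleton g))))
  have hlt : 𝔭' < 𝔭 := lt_of_le_of_ne h𝔭'le fun e => hgh 𝔭' h𝔭'min (e ▸ hh𝔭)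
  have h2 := Ideal.height_add_one_le_of_lt_of_isPrime hlt
  rw [h1] at h2
  exact h2

omit [IsDomain A] in
/-- **No minimal prime of `(g − X h) ⊆ A[X]` contains `h`** when the minimal primes of `(g, h)`
have height `≥ 2`: such a minimal prime `𝔮` would contain `g` as well, hence `𝔭 A[X]` for a
minimal prime `𝔭 ⊇ (g, h)` of `𝔮 ∩ A`, and a chain `𝔭₂ ⊊ 𝔭₁ ⊊ 𝔭` in `A` extends to a chain of
primes of `A[X]` inside `𝔮`, giving `height 𝔮 ≥ 2`, against Krull's principal ideal theorem.
[folklore] -/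
theorem C_notMem_of_mem_minimalPrimes_pencil {g h : A}
    (H : ∀ 𝔭 ∈ (Ideal.span {g, h}).minimalPrimes, 2 ≤ 𝔭.height) {𝔮 : Ideal A[X]}
    (h𝔮 : 𝔮 ∈ (Ideal.span {C g - X * C h}).minimalPrimes) : C h ∉ 𝔮 := by
  intro hh𝔮
  haveI h𝔮p : 𝔮.IsPrime := h𝔮.1.1
  have hgen : C g - X * C h ∈ 𝔮 := h𝔮.1.2 (Ideal.subset_span (Set.mem_singleton _))
  have hg𝔮 : C g ∈ 𝔮 := by
    have : C g = (C g - X * C h) + X * C h := by ring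
    rw [this]
    exact 𝔮.add_mem hgen (𝔮.mul_mem_left _ hh𝔮)
  -- `𝔮 ∩ A ⊇ (g, h)` contains a minimal prime `𝔭` of `(g, h)`, of height `≥ 2`
  set 𝔮₀ : Ideal A := 𝔮.comap (C : A →+* A[X]) with h𝔮₀
  have hle₀ : Ideal.span {g, h} ≤ 𝔮₀ := by
    rw [Ideal.span_le]
    rintro x (rfl | rfl)
    · exact hg𝔮
    · exact hh𝔮
  obtain ⟨𝔭, h𝔭min, h𝔭le⟩ := Ideal.exists_minimalPrimes_le hle₀
  haveI h𝔭p : 𝔭.IsPrime := h𝔭min.1.1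
  have h2 : 2 ≤ 𝔭.height := H 𝔭 h𝔭min
  -- a chain `𝔭₂ < 𝔭₁ < 𝔭` of primes in `A`
  obtain ⟨l, hlast, hlen⟩ := Ideal.exists_ltSeries_length_eq_height 𝔭
  have hlen2 : 2 ≤ l.length := by
    have : (2 : ℕ∞) ≤ (l.length : ℕ∞) := by rw [hlen]; exact h2
    exact_mod_cast this
  set i₁ : Fin (l.length + 1) := ⟨l.length - 1, by omega⟩
  set i₂ : Fin (l.length + 1) := ⟨l.length - 2, by omega⟩
  have hi₂₁ : l i₂ < l i₁ := l.strictMono (Fin.mk_lt_mk.mpr (by omega))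
  have hi₁ : l i₁ < l (Fin.last _) := l.strictMono (Fin.mk_lt_mk.mpr (by omega))
  have hlast' : l (Fin.last _) = ⟨𝔭, h𝔭p⟩ := hlast
  -- extend to `A[X]` and compare heights inside `𝔮`
  have hmap_lt : ∀ {P Q : PrimeSpectrum A}, P < Q →
      Ideal.map (C : A →+* A[X]) P.asIdeal < Ideal.map (C : A →+* A[X]) Q.asIdeal := by
    intro P Q hPQ
    refine lt_of_le_of_ne (Ideal.map_mono hPQ.le) fun e => ?_
    have hPQ' : ¬ Q.asIdeal ≤ P.asIdeal := not_le_of_gt hPQ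
    apply hPQ'
    intro a ha
    have : C a ∈ Ideal.map (C : A →+* A[X]) P.asIdeal := by rw [e]; exact Ideal.mem_map_of_mem _ ha
    simpa using (Ideal.mem_map_C_iff.mp this) 0
  haveI : ∀ P : PrimeSpectrum A, (Ideal.map (C : A →+* A[X]) P.asIdeal).IsPrime := fun P =>
    @Ideal.isPrime_map_C_of_isPrime A _ P.asIdeal P.2
  have hq₂₁ := Ideal.height_add_one_le_of_lt_of_isPrime (hmap_lt hi₂₁)
  have hq₁ := Ideal.height_add_one_le_of_lt_of_isPrime (hmap_lt hi₁)
  have hq𝔮 : Ideal.map (C : A →+* A[X]) (l (Fin.last _)).asIdeal ≤ 𝔮 := by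
    rw [hlast', Ideal.map_le_iff_le_comap]
    exact h𝔭le
  have h𝔮2 : (2 : ℕ∞) ≤ 𝔮.height := by
    calc (2 : ℕ∞) = 0 + 1 + 1 := by norm_num
      _ ≤ (Ideal.map (C : A →+* A[X]) (l i₂).asIdeal).height + 1 + 1 := by
        gcongr; exact zero_le
      _ ≤ (Ideal.map (C : A →+* A[X]) (l i₁).asIdeal).height + 1 := by gcongr
      _ ≤ (Ideal.map (C : A →+* A[X]) (l (Fin.last _)).asIdeal).height := hq₁
      _ ≤ 𝔮.height := Ideal.height_mono hq𝔮
  -- but `𝔮` is minimal over a principal ideal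
  have h𝔮1 : 𝔮.height ≤ 1 := Ideal.height_le_one_of_isPrincipal_of_mem_minimalPrimes _ 𝔮 h𝔮
  have : (2 : ℕ∞) ≤ 1 := h𝔮2.trans h𝔮1
  exact absurd this (by decide)

/-! ### The kernel of the pencil map -/

/-- **`ker φ = √(g − X h)`**: every minimal prime `𝔮` of `(g − X h)` avoids `h`
(`C_notMem_of_mem_minimalPrimes_pencil`), hence contains `ker φ` (if `p(g/h) = 0` then
`h^N p ∈ (g − X h) ⊆ 𝔮`); so `ker φ ⊆ ⋂ 𝔮 = √(g − X h)`, and conversely `√(g − X h) ⊆ ker φ`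
because `ker φ` is a prime containing `g − X h`. In particular `√(g − X h)` is prime: the
closed subscheme `V(g − X h) ⊆ Spec A × 𝔸¹` is irreducible with reduced structure `Spec A[g/h]`.
[folklore] -/
theorem ker_pencilHom_eq_radical {g h : A} (hh : h ≠ 0)
    (H : ∀ 𝔭 ∈ (Ideal.span {g, h}).minimalPrimes, 2 ≤ 𝔭.height) :
    RingHom.ker (pencilHom g h) = (Ideal.span {C g - X * C h}).radical := by
  apply le_antisymm
  · rw [← Ideal.sInf_minimalPrimes]
    refine le_sInf fun 𝔮 h𝔮 => ?_
    haveI := h𝔮.1.1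
    intro p hp
    have hmem := pow_natDegree_mul_mem_span_of_aeval_div_eq_zero hh (p := p) hp
    have hmem' : C h ^ p.natDegree * p ∈ 𝔮 := h𝔮.1.2 hmem
    rcases (‹𝔮.IsPrime›).mem_or_mem hmem' with h1 | h1
    · exact absurd (‹𝔮.IsPrime›.mem_of_pow_mem _ h1) (C_notMem_of_mem_minimalPrimes_pencil H h𝔮)
    · exact h1
  · haveI hprime : (RingHom.ker (pencilHom g h)).IsPrime := RingHom.ker_isPrime _
    exact (Ideal.IsPrime.radical_le_iff hprime).mpr (span_le_ker_pencilHom hh)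

/-- The radical `√(g − X h)` is a prime ideal of `A[X]` (it is the kernel of a map to a field).
[folklore] -/
theorem isPrime_radical_span_pencil {g h : A} (hh : h ≠ 0)
    (H : ∀ 𝔭 ∈ (Ideal.span {g, h}).minimalPrimes, 2 ≤ 𝔭.height) :
    (Ideal.span {C g - X * C h}).radical.IsPrime := by
  rw [← ker_pencilHom_eq_radical hh H]
  exact RingHom.ker_isPrime _

/-! ### Sections: evaluation at a common zero of `g` and `h` -/

/-- **The two points give sections of the pencil.** If `ev : A → R` is a ring map to a domain
with `ev g = ev h = 0`, then `p ↦ p^{ev}` kills `ker φ` (`= √(g − X h)`, and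
`(g − X h)^{ev} = 0`), i.e. it factors through `A[g/h] = A[X]/ker φ`. Geometrically: the line
`{x} × 𝔸¹` over a common zero `x` of `g, h` lies on the closure of the graph of `g/h`.
[folklore] -/
theorem map_eq_zero_of_mem_ker_pencilHom {g h : A} (hh : h ≠ 0)
    (H : ∀ 𝔭 ∈ (Ideal.span {g, h}).minimalPrimes, 2 ≤ 𝔭.height) {R : Type*} [CommRing R]
    [IsDomain R] (ev : A →+* R) (hg : ev g = 0) (hev : ev h = 0) {p : A[X]}
    (hp : pencilHom g h p = 0) : p.map ev = 0 := by
  have hp' : p ∈ RingHom.ker (pencilHom g h) := hp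
  rw [ker_pencilHom_eq_radical hh H] at hp'
  obtain ⟨N, hN⟩ := hp'
  have hmapI : (Ideal.span {C g - X * C h}).map (mapRingHom ev) = ⊥ := by
    rw [Ideal.map_span, Set.image_singleton]
    simp [hg, hev]
  have : (p.map ev) ^ N = 0 := by
    have h1 : mapRingHom ev (p ^ N) ∈ (Ideal.span {C g - X * C h}).map (mapRingHom ev) :=
      Ideal.mem_map_of_mem _ hN
    rw [hmapI, Ideal.mem_bot, map_pow] at h1
    exact h1
  exact IsReduced.eq_zero _ ⟨N, this⟩

/-- The ring map `σ : A[X]/ker φ → R[X]` through which `p ↦ p^{ev}` factors (the section of the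
pencil over the point `ev`). [folklore] -/
def section_ {g h : A} (hh : h ≠ 0)
    (H : ∀ 𝔭 ∈ (Ideal.span {g, h}).minimalPrimes, 2 ≤ 𝔭.height) {R : Type*} [CommRing R]
    [IsDomain R] (ev : A →+* R) (hg : ev g = 0) (hev : ev h = 0) :
    (A[X] ⧸ RingHom.ker (pencilHom g h)) →+* R[X] :=
  Ideal.Quotient.lift _ (mapRingHom ev) fun _ hp => map_eq_zero_of_mem_ker_pencilHom hh H ev hg hev hp

/-- The section sends the class of `p` to `p^{ev}`. [folklore] -/
@[simp] theorem section_mk {g h : A} (hh : h ≠ 0)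
    (H : ∀ 𝔭 ∈ (Ideal.span {g, h}).minimalPrimes, 2 ≤ 𝔭.height) {R : Type*} [CommRing R]
    [IsDomain R] (ev : A →+* R) (hg : ev g = 0) (hev : ev h = 0) (p : A[X]) :
    section_ hh H ev hg hev (Ideal.Quotient.mk _ p) = p.map ev := rfl

/-- **The ring `A[g/h] ⊆ Frac A` of the pencil** (the image of `φ`), the coordinate ring of the
chart `h ≠ 0` of the blow-up of `(g, h)`. [folklore] -/
abbrev pencilRing (g h : A) : Subalgebra A (FractionRing A) := (pencilHom g h).range

/-- The section over the point `ev` as a ring map `A[g/h] → R[X]` (through `A[g/h] ≅ A[X]/ker φ`).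
[folklore] -/
def sectionOfZero {g h : A} (hh : h ≠ 0)
    (H : ∀ 𝔭 ∈ (Ideal.span {g, h}).minimalPrimes, 2 ≤ 𝔭.height) {R : Type*} [CommRing R]
    [IsDomain R] (ev : A →+* R) (hg : ev g = 0) (hev : ev h = 0) : pencilRing g h →+* R[X] :=
  (section_ hh H ev hg hev).comp
    (Ideal.quotientKerEquivRange (pencilHom g h)).symm.toRingEquiv.toRingHom

/-- The section sends `p(g/h)` to `p^{ev}`. [folklore] -/
theorem sectionOfZero_apply {g h : A} (hh : h ≠ 0)
    (H : ∀ 𝔭 ∈ (Ideal.span {g, h}).minimalPrimes, 2 ≤ 𝔭.height) {R : Type*} [CommRing R]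
    [IsDomain R] (ev : A →+* R) (hg : ev g = 0) (hev : ev h = 0) (p : A[X]) :
    sectionOfZero hh H ev hg hev ⟨pencilHom g h p, p, rfl⟩ = p.map ev := by
  have h1 : (Ideal.quotientKerEquivRange (pencilHom g h)).symm ⟨pencilHom g h p, p, rfl⟩ =
      Ideal.Quotient.mk _ p := by
    rw [AlgEquiv.symm_apply_eq]
    rfl
  change section_ hh H ev hg hev ((Ideal.quotientKerEquivRange (pencilHom g h)).symm _) = _
  rw [h1]
  rfl

/-- In particular `σ(g/h) = X`. [folklore] -/
theorem sectionOfZero_div {g h : A} (hh : h ≠ 0)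
    (H : ∀ 𝔭 ∈ (Ideal.span {g, h}).minimalPrimes, 2 ≤ 𝔭.height) {R : Type*} [CommRing R]
    [IsDomain R] (ev : A →+* R) (hg : ev g = 0) (hev : ev h = 0) :
    sectionOfZero hh H ev hg hev ⟨algebraMap A _ g / algebraMap A _ h, X, pencilHom_X g h⟩ = X := by
  have := sectionOfZero_apply hh H ev hg hev X
  simp only [pencilHom_X, Polynomial.map_X] at this
  convert this using 2

/-- and `σ(a) = ev a` for `a ∈ A`. [folklore] -/
theorem sectionOfZero_algebraMap {g h : A} (hh : h ≠ 0)
    (H : ∀ 𝔭 ∈ (Ideal.span {g, h}).minimalPrimes, 2 ≤ 𝔭.height) {R : Type*} [CommRing R]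
    [IsDomain R] (ev : A →+* R) (hg : ev g = 0) (hev : ev h = 0) (a : A) :
    sectionOfZero hh H ev hg hev (algebraMap A (pencilRing g h) a) = C (ev a) := by
  have := sectionOfZero_apply hh H ev hg hev (C a)
  simp only [pencilHom_C, Polynomial.map_C] at this
  convert this using 2
  exact Subtype.ext rfl

/-! ### Choosing `g` and `h` by prime avoidance -/

omit [IsNoetherianRing A] in
/-- Distinct maximal ideals of a domain meet in a nonzero ideal. [folklore] -/
theorem inf_ne_bot_of_isMaximal_of_ne {m₁ m₂ : Ideal A} [m₁.IsMaximal] [m₂.IsMaximal]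
    (hne : m₁ ≠ m₂) : m₁ ⊓ m₂ ≠ ⊥ := by
  intro h
  have hmul : m₁ * m₂ = ⊥ := le_bot_iff.mp (Ideal.mul_le_inf.trans h.le)
  rcases Ideal.mul_eq_bot.mp hmul with h1 | h2
  · exact hne (Ideal.IsMaximal.eq_of_le inferInstance (Ideal.IsMaximal.ne_top inferInstance)
      (by rw [h1]; exact bot_le))
  · exact hne (Ideal.IsMaximal.eq_of_le inferInstance (Ideal.IsMaximal.ne_top inferInstance)
      (by rw [h2]; exact bot_le)).symm

/-- **Prime avoidance for the pencil.** If `𝔪₁ ≠ 𝔪₂` are maximal ideals of height `≥ 2` of a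
noetherian domain, there are `g ≠ 0` and `h` in `𝔪₁ ∩ 𝔪₂` with `h` in no minimal prime of `(g)`:
take any `g ≠ 0` in `𝔪₁ ∩ 𝔪₂`; the minimal primes `𝔭` of `(g)` have height `1`, so none contains
`𝔪₁ ∩ 𝔪₂ ⊇ 𝔪₁𝔪₂` (it would contain, hence equal, some `𝔪ᵢ` of height `≥ 2`), and prime
avoidance gives `h`. [folklore] -/
theorem exists_mem_inf_notMem_minimalPrimes {m₁ m₂ : Ideal A} [m₁.IsMaximal] [m₂.IsMaximal]
    (hne : m₁ ≠ m₂) (h₁ : 2 ≤ m₁.height) (h₂ : 2 ≤ m₂.height) :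
    ∃ g h : A, g ≠ 0 ∧ g ∈ m₁ ⊓ m₂ ∧ h ∈ m₁ ⊓ m₂ ∧
      ∀ 𝔭 ∈ (Ideal.span {g}).minimalPrimes, h ∉ 𝔭 := by
  classical
  obtain ⟨g, hgm, hg0⟩ := Submodule.exists_mem_ne_zero_of_ne_bot (inf_ne_bot_of_isMaximal_of_ne hne)
  let S : Set (Ideal A) := (Ideal.span {g}).minimalPrimes
  have hSfin : S.Finite := Ideal.finite_minimalPrimes_of_isNoetherianRing A _
  have hSprime : ∀ p ∈ S, p ≠ ⊥ → p ≠ ⊥ → p.IsPrime := fun p hp _ _ => hp.1.1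
  have hnot : ¬ ((↑(m₁ ⊓ m₂) : Set A) ⊆ ⋃ p ∈ S, (p : Set A)) := by
    rw [Ideal.subset_union_prime_finite hSfin ⊥ ⊥ hSprime]
    rintro ⟨p, hp, hle⟩
    haveI := hp.1.1
    have hp1 : p.height ≤ 1 := Ideal.height_le_one_of_isPrincipal_of_mem_minimalPrimes _ p hp
    have hmul : m₁ * m₂ ≤ p := Ideal.mul_le_inf.trans hle
    rcases (Ideal.IsPrime.mul_le inferInstance).mp hmul with hm | hm
    · have := Ideal.IsMaximal.eq_of_le inferInstance (Ideal.IsPrime.ne_top inferInstance) hm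
      rw [this] at h₁
      exact absurd (h₁.trans hp1) (by decide)
    · have := Ideal.IsMaximal.eq_of_le inferInstance (Ideal.IsPrime.ne_top inferInstance) hm
      rw [this] at h₂
      exact absurd (h₂.trans hp1) (by decide)
  obtain ⟨h, hhm, hhS⟩ := Set.not_subset.mp hnot
  simp only [Set.mem_iUnion, SetLike.mem_coe, exists_prop, not_exists, not_and] at hhS
  exact ⟨g, h, hg0, hgm, hhm, fun 𝔭 h𝔭 => hhS 𝔭 h𝔭⟩

end TwoPointPencil

end Literature.AlgebraicGeometry.Motives

end
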